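import Summits.Ventures.PercRepro.Night2OneFatCaseOneAssemblyA
import Summits.Ventures.PercRepro.Night2OneFatSourcesC

/-!
# PercRepro — the case-1 assembly, part B: the thin faces of a source and its good points (night-2, gen 29)

For a source `y₁` of the one-coloop target `S` (coloops of `(S ∖ K) ∖ y₁` = `{w, y₂, y₃}`), the thin faces of `S ∖ y₁` are the
three faces at `w, y₂, y₃`, whose closures are `H = cl (S ∖ w)` (`clF_face_coloop_eq`), `cl ((S ∖ y₁) ∖ y₂) = cl (insert y₃ P)`
and `cl ((S ∖ y₁) ∖ y₃) = cl (insert y₂ P)`.  An outside point in at most one of these three closures is a good point of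
`S ∖ y₁`, as is `y₁` itself: **`card_gtPts_ge_outside`** — `#gtPts (S ∖ y₁) ≥ 1 + #{x ∈ G ∖ S : [x ∈ H] + [x ∈ H′₂] + [x ∈ H′₃] ≤ 1}`
(§4⁗ F, the lower bound on `g₁`).

* `coloops_eq_triple`, `thinFacesOf_eq_triple`, `face_eq_insert_base`, **`card_gtPts_ge_outside`**.
-/

namespace PercRepro.Shadow

open Finset PerFlat ThmH

variable {α : Type*} [DecidableEq α] {M : Matroid α} [M.Finite] {G : Finset α}

section AssemblyB

/-- Three distinct coloops of a set with exactly three coloops are all of them. -/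
theorem coloops_eq_triple {Y : Finset α} (hC : (coloops M Y).card = 3) {w y₂ y₃ : α} (hw : w ∈ coloops M Y)
    (hy₂ : y₂ ∈ coloops M Y) (hy₃ : y₃ ∈ coloops M Y) (h12 : w ≠ y₂) (h13 : w ≠ y₃) (h23 : y₂ ≠ y₃) :
    coloops M Y = {w, y₂, y₃} := by
  symm
  apply Finset.eq_of_subset_of_card_le
  · intro a ha
    rw [Finset.mem_insert, Finset.mem_insert, Finset.mem_singleton] at ha
    rcases ha with rfl | rfl | rfl
    · exact hw
    · exact hy₂
    · exact hy₃
  · rw [hC, Finset.card_insert_of_notMem, Finset.card_pair h23]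
    rw [Finset.mem_insert, Finset.mem_singleton]
    push Not
    exact ⟨h12, h13⟩

/-- `(S ∖ y₁) ∖ y₂ = insert y₃ (((S ∖ y₁) ∖ y₂) ∖ y₃)` for `y₃ ∈ S`, `y₃ ≠ y₁, y₂`. -/
theorem face_eq_insert_base {S : Finset α} {y₁ y₂ y₃ : α} (hy₃ : y₃ ∈ S) (h13 : y₁ ≠ y₃) (h23 : y₂ ≠ y₃) :
    (S.erase y₁).erase y₂ = insert y₃ (((S.erase y₁).erase y₂).erase y₃) := by
  rw [Finset.insert_erase (Finset.mem_erase.2 ⟨h23.symm, Finset.mem_erase.2 ⟨h13.symm, hy₃⟩⟩)]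

/-- `(S ∖ y₁) ∖ y₃ = insert y₂ (((S ∖ y₁) ∖ y₂) ∖ y₃)` for `y₂ ∈ S`, `y₂ ≠ y₁, y₃`. -/
theorem face_eq_insert_base' {S : Finset α} {y₁ y₂ y₃ : α} (hy₂ : y₂ ∈ S) (h12 : y₁ ≠ y₂) (h23 : y₂ ≠ y₃) :
    (S.erase y₁).erase y₃ = insert y₂ (((S.erase y₁).erase y₂).erase y₃) := by
  ext a
  simp only [Finset.mem_erase, Finset.mem_insert]
  constructor
  · rintro ⟨ha3, ha1, haS⟩
    by_cases ha2 : a = y₂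
    · exact Or.inl ha2
    · exact Or.inr ⟨ha3, ha2, ha1, haS⟩
  · rintro (rfl | ⟨ha3, -, ha1, haS⟩)
    · exact ⟨h23, h12.symm, hy₂⟩
    · exact ⟨ha3, ha1, haS⟩

open scoped Classical in
/-- **The good points of a source are at least `1` plus the outside points in at most one of the three face closures.**
`S ⊆ G`, `coloops (S ∖ K) = {w}`, `y₁ ∈ S` a source whose erasure has coloops `{w, y₂, y₃}` off `K`. -/
theorem card_gtPts_ge_outside (hG : G ∈ flatsQ M (5 + 1)) (hd : (gr M \ G).card = 2) (hk : kColoops M G = 1)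
    (hs : ∀ e ∈ gr M, ∀ f ∈ gr M, e ≠ f → rkN M {e, f} = 2) (hl : ∀ e ∈ gr M, M.Indep {e})
    {S : Finset α} (hSG : S ⊆ G) {w : α} (hc : coloops M (S \ coloops M G) = {w}) {y₁ : α} (hy₁ : y₁ ∈ S)
    {w₀ : α} (hw₀ : w₀ ∈ S.erase y₁) (h0 : faceLossP M 5 G (bigP M G) (S.erase y₁) w₀ ≠ 0)
    {y₂ y₃ : α} (hC : coloops M (S.erase y₁ \ coloops M G) = {w, y₂, y₃}) (h12 : w ≠ y₂) (h13 : w ≠ y₃)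
    (h23 : y₂ ≠ y₃) :
    1 + ((G \ S).filter (fun x => (decide (x ∈ clF M (S.erase w))).toNat +
      (decide (x ∈ clF M ((S.erase y₁).erase y₃))).toNat +
      (decide (x ∈ clF M ((S.erase y₁).erase y₂))).toNat ≤ 1)).card ≤ (gtPts M 5 G (S.erase y₁)).card := by
  obtain ⟨hQG, hQ5, hC3, hImg, -, -⟩ := lossy_structure_of_faceLossP_ne_zero hG hd hk hs hl hw₀ h0
  -- `y₁` is a good point, not the coloop, off `K`
  have hy₁good := mem_gtPts_of_source_one_coloop hG hd hk hs hl hSG hc hy₁ hw₀ h0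
  have hwc : w ∈ coloops M (S \ coloops M G) := by rw [hc]; exact Finset.mem_singleton_self _
  have hy₁w : y₁ ≠ w := by
    intro h
    exact h0 (by rw [h]; exact faceLossP_eq_zero_of_mem_coloops hG hd hk hs hl hSG hwc (h ▸ hw₀))
  have hy₁K : y₁ ∉ coloops M G := by
    intro hK
    obtain ⟨hthin, -, -, -⟩ := faceLossP_structure h0
    exact (Finset.notMem_erase y₁ S) ((Finset.erase_subset _ _) (coloops_subset_of_mem_thinMembers hG (by omega) hthin hK))
  have hy₁V : y₁ ∈ S \ coloops M G := Finset.mem_sdiff.2 ⟨hy₁, hy₁K⟩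
  -- the coloops `y₂, y₃ ∈ (S.erase y₁) ∖ K`, and `S ∖ K` has rank `5`
  have hy₂Q : y₂ ∈ (S.erase y₁) \ coloops M G := by
    have : y₂ ∈ coloops M ((S.erase y₁) \ coloops M G) := by rw [hC]; simp
    exact (mem_coloops.1 this).1
  have hy₃Q : y₃ ∈ (S.erase y₁) \ coloops M G := by
    have : y₃ ∈ coloops M ((S.erase y₁) \ coloops M G) := by rw [hC]; simp
    exact (mem_coloops.1 this).1
  have hy₂S : y₂ ∈ S := (Finset.erase_subset _ _) (Finset.mem_sdiff.1 hy₂Q).1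
  have hy₃S : y₃ ∈ S := (Finset.erase_subset _ _) (Finset.mem_sdiff.1 hy₃Q).1
  have h1₂ : y₁ ≠ y₂ := fun h => (Finset.mem_erase.1 (Finset.mem_sdiff.1 hy₂Q).1).1 h.symm
  have h1₃ : y₁ ≠ y₃ := fun h => (Finset.mem_erase.1 (Finset.mem_sdiff.1 hy₃Q).1).1 h.symm
  have hGg : G ⊆ gr M := (mem_flatsQ.1 hG).1
  have hS5 : rkN M (S \ coloops M G) = 5 := by
    have ha : rkN M ((S.erase y₁) \ coloops M G) ≤ rkN M (S \ coloops M G) :=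
      rkN_mono (Finset.sdiff_subset_sdiff (Finset.erase_subset _ _) (Finset.Subset.refl _))
    have hb : rkN M (S \ coloops M G) ≤ rkN M (G \ coloops M G) :=
      rkN_mono (Finset.sdiff_subset_sdiff hSG (Finset.Subset.refl _))
    rw [rkN_sdiff_coloops_eq_five hG hk] at hb
    omega
  have hy₁c : y₁ ∉ coloops M (S \ coloops M G) := by rw [hc, Finset.mem_singleton]; exact hy₁w
  -- the closure of the face at `w` is `cl (S ∖ w)`
  have hHw : clF M ((S.erase y₁).erase w) = clF M (S.erase w) := clF_face_coloop_eq hG hSG hS5 hwc hy₁V hy₁w hy₁c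
  -- the thin faces of `(S.erase y₁)` are the faces at `w, y₂, y₃`
  have hfaces : thinFacesOf M 5 G (S.erase y₁) = {(S.erase y₁).erase w, (S.erase y₁).erase y₂, (S.erase y₁).erase y₃} := by
    rw [hImg, hC]
    rw [Finset.image_insert, Finset.image_insert, Finset.image_singleton]
  -- the outside good points are good points of `(S.erase y₁)`
  have hsub : insert y₁ ((G \ S).filter (fun x => (decide (x ∈ clF M (S.erase w))).toNat +
      (decide (x ∈ clF M ((S.erase y₁).erase y₃))).toNat +
      (decide (x ∈ clF M ((S.erase y₁).erase y₂))).toNat ≤ 1)) ⊆ gtPts M 5 G (S.erase y₁) := by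
    intro x hx
    rw [Finset.mem_insert] at hx
    rcases hx with rfl | hx
    · exact hy₁good
    rw [Finset.mem_filter, Finset.mem_sdiff] at hx
    obtain ⟨⟨hxG, hxS⟩, hgood⟩ := hx
    refine mem_goodPts.2 ⟨Finset.mem_sdiff.2 ⟨hxG, fun h => hxS ((Finset.erase_subset _ _) h)⟩, ?_⟩
    rw [hfaces]
    -- the three faces are distinct
    have hne₁ : (S.erase y₁).erase w ≠ (S.erase y₁).erase y₂ := by
      intro h
      have : y₂ ∈ (S.erase y₁).erase w := Finset.mem_erase.2 ⟨h12.symm, (Finset.mem_sdiff.1 hy₂Q).1⟩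
      rw [h] at this
      exact (Finset.notMem_erase y₂ (S.erase y₁)) this
    have hne₂ : (S.erase y₁).erase w ≠ (S.erase y₁).erase y₃ := by
      intro h
      have : y₃ ∈ (S.erase y₁).erase w := Finset.mem_erase.2 ⟨h13.symm, (Finset.mem_sdiff.1 hy₃Q).1⟩
      rw [h] at this
      exact (Finset.notMem_erase y₃ (S.erase y₁)) this
    have hne₃ : (S.erase y₁).erase y₂ ≠ (S.erase y₁).erase y₃ := by
      intro h
      have : y₃ ∈ (S.erase y₁).erase y₂ := Finset.mem_erase.2 ⟨h23.symm, (Finset.mem_sdiff.1 hy₃Q).1⟩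
      rw [h] at this
      exact (Finset.notMem_erase y₃ (S.erase y₁)) this
    rw [Finset.filter_insert, Finset.filter_insert, Finset.filter_singleton]
    rw [hHw] at *
    -- count the faces containing `x` by cases
    have hgood' := hgood
    by_cases hxw : x ∈ clF M (S.erase w) <;> by_cases hx2 : x ∈ clF M ((S.erase y₁).erase y₂) <;>
      by_cases hx3 : x ∈ clF M ((S.erase y₁).erase y₃) <;> simp_all [Finset.card_insert_of_notMem]
  have hdisj : y₁ ∉ (G \ S).filter (fun x => (decide (x ∈ clF M (S.erase w))).toNat +
      (decide (x ∈ clF M ((S.erase y₁).erase y₃))).toNat +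
      (decide (x ∈ clF M ((S.erase y₁).erase y₂))).toNat ≤ 1) := by
    rw [Finset.mem_filter, Finset.mem_sdiff]
    rintro ⟨⟨-, h⟩, -⟩
    exact h hy₁
  have := Finset.card_le_card hsub
  rw [Finset.card_insert_of_notMem hdisj] at this
  omega

end AssemblyB

end PercRepro.Shadow
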